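import Summits.KontsevichZagierPeriods.KontsevichZagierPeriods.Theses.FurushoPentagon

/-!
# Route FurushoPentagon — `Assembly`: the route's items imply the summit statement

Problem `KontsevichZagierPeriods`, route `FurushoPentagon`, item stmt-KontsevichZagierPeriods-10718
(`Assembly`, assembly, rank 1). The route declaration `Assembly` is the curried implication
`StuffleInKZ → HoffmanRelationInKZ → SectorToKernel → KontsevichZagierPeriods`: the two typed
double-shuffle families of the route (the stuffle product and Hoffman's relation, both realised
inside `KZ.relations`) together with the complement item `SectorToKernel` (which, given those two
families, concludes the kernel form `∀ c, KZ.eval c = 0 → c ∈ KZ.relations` of Kontsevich–Zagier's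
Conjecture 1) imply the summit statement `KontsevichZagierPeriods` (two rational-shape integral
representations with equal values are equivalent under the four moves). At route rev 1 this was
literally the type of the route's deciding theorem `FurushoPentagon.closes`, and the item was settled
by citing it; since the judge-repair of 2026-08-16 (rev 20) `closes` takes the finer hypotheses
`PentagonInKZ, ReducedPeriodRing, MzvPeriodConjecture, KernelModuloPeriodConjecture, StuffleInKZ,
HoffmanRelationInKZ` instead (full build 2026-08-16: type mismatch at the citation), so the
two-line argument of `closes` is now repeated here against `SectorToKernel` directly (kernel form ⇒
statement: for representations `r, r'` with equal values, `KZ.eval ([r] - [r']) = 0`, so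
`[r] - [r']` is a relation).

Sources: M. Kontsevich, D. Zagier, *Periods* (2001), §1.2 (Conjecture 1 and its kernel
reformulation); H. Furusho, *Double shuffle relation for associators*, Ann. of Math. 174 (2011),
Thm 1.2 (the lever behind the route's items). Deliberately NOT here: any claim about the three
hypotheses themselves — the result is the implication only (unconditional as an implication).
-/

namespace Summit.KontsevichZagierPeriods.FurushoPentagon

/-- Settles stmt-KontsevichZagierPeriods-10718: the route declaration `FurushoPentagon.Assembly`
(`StuffleInKZ → HoffmanRelationInKZ → SectorToKernel → KontsevichZagierPeriods`) holds — given
the two double-shuffle families, `SectorToKernel` yields the kernel form of Conjecture 1, and equal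
values of two representations `r, r'` give `KZ.eval ([r] - [r']) = 0` (`KZ.eval_of`), hence
`[r] - [r'] ∈ KZ.relations`, which is the summit statement's conclusion (the argument of the route's
deciding theorem `FurushoPentagon.closes`, whose own hypotheses were refined at rev 20).
[Kontsevich–Zagier 2001, §1.2] [folklore] -/
theorem assembly_proof :
    Summit.KontsevichZagierPeriods.KontsevichZagierPeriods.Theses.FurushoPentagon.Assembly := by
  unfold Summit.KontsevichZagierPeriods.KontsevichZagierPeriods.Theses.FurushoPentagon.Assembly
  intro hS hH hK n m r r' _ _ hv
  have h0 : Literature.NumberTheory.Transcendental.KZ.eval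
      (Literature.NumberTheory.Transcendental.KZ.of r - Literature.NumberTheory.Transcendental.KZ.of r') = 0 := by
    simp [Literature.NumberTheory.Transcendental.KZ.eval_of, hv]
  exact hK hS hH _ h0

end Summit.KontsevichZagierPeriods.FurushoPentagon
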